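import Literature.Geometry.Lorentzian.KillingInitialDataPairing
import Literature.Geometry.Lorentzian.TetradCompleteness
import Literature.Geometry.Lorentzian.ModelSpaceNormalDerivative
import Literature.Geometry.Lorentzian.InducedVacuumData
import Literature.Geometry.Lorentzian.ModelDataProofs
import Literature.Geometry.Lorentzian.MinkowskiFlat
import Literature.Analysis.Calculus.PoincareLemmaOneFormStarConvex
import Mathlib.Analysis.InnerProductSpace.Calculus
import HarnessLib

/-!
# Translational Killing initial data integrate to a spacelike immersion into Minkowski space-time

The rigid positive energy theorem (Beig–Chruściel, J. Math. Phys. 37 (1996), Thm. 4.1, case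
`m = 0`; vendored as the named fact `positive_mass_rigidity_spacetime`,
`SpacetimePositiveMassRigidity.lean`) is proved in two halves. The analytic half (Witten's
argument, App. A of the paper) produces from `m = 0` four pairs `(N_a, Y_a)` — a function and a
vector field on the data manifold `(Σ, h, k)`, the lapse and shift of the bilinear of a
Sen-parallel spinor — solving the **translational (parallel) KID system** (A.11)–(A.11.0),

  `h(∇ᵥY_a, w) = −N_a k(v, w)`,  `dN_a(v) = −k(v, Y_a)`,

with Minkowskian Gram matrix `−N_a N_b + h(Y_a, Y_b) = η_{ab}` (from the asymptotic values).
The geometric half (§4, pp. 12–13) shows that such data are a slice of Minkowski space-time: the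
Killing development of the KIDs is flat, `Σ` embeds isometrically with second fundamental form
`k`, and globally the image is an entire spacelike graph. This file proves the **local geometric
half in initial-data form**, spinor-free, by the classical developing-map construction: on an
open star-shaped chart domain `U ⊆ ℝ³`,

* `PseudoRiemannianMetric.mvfderiv_val_kid_comm` — the first KID equation makes the covector
  fields `h(Y_a, ·)` closed (metric compatibility and torsion-freeness of the Levi-Civita
  connection, O'Neill 1983, Thm. 3.11; any dimension and signature);
* `InitialDataSet.exists_developingMap_of_kid` — hence (Poincaré lemma on star-shaped sets,
  `Literature.Analysis.Calculus.exists_contDiffOn_hasFDerivAt_of_fderiv_symm_of_starConvex`)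
  there is a `C^∞` map `f : U → ℝ⁴` with `df(v) = (ε_a h(Y_a, v))_a`, `ε = (−1, 1, 1, 1)`;
* `InitialDataSet.kidPairing_eq_of_isPreconnected` — the Gram matrix `−N_a N_b + h(Y_a, Y_b)` is
  constant on a connected chart domain (the conservation law
  `mvfderiv_kidPairing_eq_zero` of `KillingInitialDataPairing.lean`);
* `InitialDataSet.exists_spacelikeImmersion_minkowski_of_kids` — **main result**: if the Gram
  matrix is `η` and `N₀ > 0`, then `f` is a spacelike immersion into `(ℝ⁴, η)` with future unit
  normal `ν = (−ε_a N_a)_a`, smooth lift, induced metric `f^*η = h` and second fundamental form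
  `K_ν = k` — the completeness relations of the `η`-orthonormal frame `(N_a, Y_a)` of `ℝ ⊕ T_xU`
  (`lapseShift_completeness`, `TetradCompleteness.lean`; `eq_sum_smul_shift_of_gram_eq` below)
  and the flat normal derivative `K_ν(v, w) = η(dν v, df w)`
  (`ModelSpace.secondFundamentalForm_eq_mfderiv`, `ModelSpaceNormalDerivative.lean`);
* `InitialDataSet.exists_spacelikeImmersion_minkowski_of_kids_of_gram_at` — the same with the
  Gram condition and `N₀ > 0` imposed at one point only;
* `InitialDataSet.isVacuumConstraintSolution_of_minkowski_immersion`,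
  `InitialDataSet.isVacuumConstraintSolution_of_kids`, `InitialDataSet.kids_neg`,
  `InitialDataSet.isVacuumConstraintSolution_of_kids_of_gram_at` — consequences: data induced by an
  immersion into Minkowski space-time are vacuum, hence so are data carrying translational KIDs
  with Minkowskian Gram matrix at one point (no sign condition: `(−N_a, −Y_a)` are KIDs too) —
  the clause "`ρ ≡ Jⁱ ≡ 0`" of Thm. 4.1 in the KID formulation.

So the existence of translational KIDs with Minkowskian Gram matrix forces the vacuum
constraints and realises `(U, h, k)` as a hypersurface of Minkowski space-time; the global
statement (entire graph, Cauchy development `= Minkowski.spacetime`) additionally needs simple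
connectivity/completeness (`Literature.Geometry.Manifold.GStructureDevelopment` for the
monodromy step) and is not attempted here. Theorems only; no definitions, no named facts.

## References

* R. Beig, P. T. Chruściel, *Killing vectors in asymptotically flat space-times. I.*, J. Math.
  Phys. 37 (1996) 1939–1961, arXiv:gr-qc/9510015: Thm. 4.1 and its proof (§4), App. A,
  (A.11)–(A.11.0). [BeigChrusciel1996]
* V. Moncrief, *Spacetime symmetries and linearization stability of the Einstein equations. I*,
  J. Math. Phys. 16 (1975) 493–498, §III (Killing initial data). [Moncrief1975]
* R. M. Wald, *General Relativity*, Chicago 1984, §3.4b and §10.2, (10.2.11)–(10.2.13).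
  [Wald1984]
* B. O'Neill, *Semi-Riemannian geometry*, Academic Press 1983, Ch. 3, Thm. 3.11; Ch. 4,
  Lemma 4.4. [ONeill1983]
* M. Spivak, *Calculus on Manifolds*, Benjamin 1965, Thm. 4-11 (Poincaré lemma). [Spivak1965]
-/

noncomputable section

open Bundle Set Function TopologicalSpace Manifold Module
open scoped Manifold ContDiff Topology

namespace Literature.Geometry.Lorentzian

/-! ### The metric dual of a translational KID vector field is closed -/

section KIDClosed

variable {E' : Type*} [NormedAddCommGroup E'] [NormedSpace ℝ E'] [FiniteDimensional ℝ E']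
  [CompleteSpace E'] {U : Opens E'} {n : ℕ∞ω}
  (g : PseudoRiemannianMetric 𝓘(ℝ, E') n E' (TangentSpace 𝓘(ℝ, E') : U → Type _))
  [Fact (1 ≤ n)] [g.HasLeviCivita]

/-- **The metric dual of a translational KID vector field is a closed `1`-form.** On a chart
domain `U`, let `g` be a `C¹` pseudo-Riemannian metric with its Levi-Civita connection `∇`, `k`
a field of bilinear forms symmetric at `x`, and `(N, Y)` a pair with `Y` differentiable at `x`
satisfying there the first translational KID equation `g(∇_v Y, w) = −N k(v, w)` for all `v, w`
(Beig–Chruściel 1996, App. A, (A.11): `DᵢYⱼ + N Kᵢⱼ = 0`). Then the covector field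
`Y♭ = g(Y, ·)` is closed at `x`: `∂ᵥ[g(Y, w)] = ∂_w[g(Y, v)]` for all constant `v, w` — by metric
compatibility `∂ᵥ g(Y, w) = g(∇ᵥY, w) + g(Y, ∇ᵥ w)`, the symmetry of `N k`, and torsion-freeness
`∇ᵥ w − ∇_w v = [v, w] = 0` for the constant fields `v, w` of the chart (O'Neill 1983, Ch. 3,
Thm. 3.11 (D3)–(D4)). This is the step "`DᵢYⱼ` symmetric ⟹ `Y` is locally a gradient" of the
integration of the KIDs in the proof of Beig–Chruściel, J. Math. Phys. 37 (1996), Thm. 4.1.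
[cite: BeigChrusciel1996, proof of Thm. 4.1 and App. A (A.11)] -/
theorem PseudoRiemannianMetric.mvfderiv_val_kid_comm
    (k : Π x : U, TangentSpace 𝓘(ℝ, E') x →L[ℝ] TangentSpace 𝓘(ℝ, E') x →L[ℝ] ℝ) {x : U}
    {Y : Π x : U, TangentSpace 𝓘(ℝ, E') x} {N : U → ℝ} (hY : MDiffAt (T% Y) x)
    (hk : ∀ v w, k x v w = k x w v)
    (hDY : ∀ v w, g.val x (g.leviCivita Y x v) w = -(N x * k x v w)) (v w : E') :
    mvfderiv 𝓘(ℝ, E') (fun y ↦ g.val y (Y y) w) x v =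
      mvfderiv 𝓘(ℝ, E') (fun y ↦ g.val y (Y y) v) x w := by
  have hLC : g.IsLeviCivita g.leviCivita := isLeviCivita_leviCivita_holds (g := g)
  have hV := OpensChart.mdifferentiableAt_const_section x v
  have hW := OpensChart.mdifferentiableAt_const_section x w
  have h1 : mvfderiv 𝓘(ℝ, E') (fun y ↦ g.val y (Y y) w) x v =
      g.val x (g.leviCivita Y x v) w +
        g.val x (Y x) (g.leviCivita (fun _ ↦ w : Π y : U, TangentSpace 𝓘(ℝ, E') y) x v) :=
    hLC.2 hV hY hW
  have h2 : mvfderiv 𝓘(ℝ, E') (fun y ↦ g.val y (Y y) v) x w =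
      g.val x (g.leviCivita Y x w) v +
        g.val x (Y x) (g.leviCivita (fun _ ↦ v : Π y : U, TangentSpace 𝓘(ℝ, E') y) x w) :=
    hLC.2 hW hY hV
  have ht := g.leviCivita.torsion_apply hV hW
  rw [hLC.1, OpensChart.mlieBracket_const] at ht
  simp only [Pi.zero_apply, _root_.zero_apply, sub_zero] at ht
  rw [h1, h2, hDY, hDY, hk v w, eq_of_sub_eq_zero ht.symm]

end KIDClosed

/-! ### Coordinate algebra on `ℝ⁴` -/

namespace Minkowski

/-- `η` of two vectors given by coordinates: `η(c, d) = ∑_a ε_a c_a d_a`, `ε = (−1, 1, 1, 1)`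
(O'Neill 1983, Ch. 3, p. 55: `ℝ⁴₁`). [cite: ONeill1983, Ch. 3, p. 55] -/
theorem bilin_toLp (c d : Fin 4 → ℝ) :
    bilin (WithLp.toLp 2 c) (WithLp.toLp 2 d) = ∑ a, (if a = 0 then -1 else 1 : ℝ) * c a * d a := by
  rw [bilin_apply]
  conv_rhs => rw [Fin.sum_univ_succ]
  simp only [Fin.succ_ne_zero, if_true, if_false, one_mul, neg_mul]

/-- `η(∂ₜ, c) = −c₀` for a vector given by coordinates (O'Neill 1983, Ch. 3, p. 55).
[cite: ONeill1983, Ch. 3, p. 55] -/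
theorem bilin_basisVector_zero_toLp (c : Fin 4 → ℝ) :
    bilin (E4.basisVector 0) (WithLp.toLp 2 c) = -c 0 := by
  rw [bilin_apply]
  simp [Fin.succ_ne_zero]

/-- `ε_a² = 1` for the signs `ε = (−1, 1, 1, 1)` of `η`. [folklore] -/
private theorem sign_mul_sign (a : Fin 4) :
    (if a = 0 then -1 else 1 : ℝ) * (if a = 0 then -1 else 1) = 1 := by
  split_ifs <;> norm_num

/-- The coordinates of the differential of an `ℝ⁴`-valued map are the differentials of its
coordinates. [folklore] -/
private theorem fderiv_apply_coord {V : E3 → E4} {z : E3} (hV : DifferentiableAt ℝ V z)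
    (i : Fin 4) (v : E3) : (fderiv ℝ V z v) i = fderiv ℝ (fun z ↦ V z i) z v := by
  have h := ((EuclideanSpace.proj (𝕜 := ℝ) i).hasFDerivAt.comp z hV.hasFDerivAt).fderiv
  rw [show (fun z ↦ V z i) = (EuclideanSpace.proj (𝕜 := ℝ) i) ∘ V from rfl, h]
  rfl

end Minkowski

/-- **Expansion of a spatial vector in the shifts of a lapse–shift tetrad.** If
`−N_a N_b + q(Y_a, Y_b) = η_{ab}` for a bilinear form `q` on `ℝ³`, then every `z ∈ ℝ³`
expands as `z = ∑_a ε_a q(z, Y_a) Y_a` (the spatial component of the expansion of `(0, z)` in the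
`η`-orthonormal frame `(N_a, Y_a)` of `ℝ ⊕ ℝ³`, `eq_sum_smul_of_gram_eq`). Wald 1984, §3.4b,
(3.4.19); used with `lapseShift_completeness`. [cite: Wald1984, §3.4b] -/
theorem eq_sum_smul_shift_of_gram_eq (q : LinearMap.BilinForm ℝ E3) (N : Fin 4 → ℝ)
    (Y : Fin 4 → E3)
    (hG : ∀ a b, -(N a * N b) + q (Y a) (Y b) = if a = b then (if a = 0 then -1 else 1) else 0)
    (z : E3) : z = ∑ a, ((if a = 0 then -1 else 1 : ℝ) * q z (Y a)) • Y a := by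
  let Q : LinearMap.BilinForm ℝ (ℝ × E3) :=
    q.compl₁₂ (LinearMap.snd ℝ ℝ E3) (LinearMap.snd ℝ ℝ E3) -
      (LinearMap.mul ℝ ℝ).compl₁₂ (LinearMap.fst ℝ ℝ E3) (LinearMap.fst ℝ ℝ E3)
  have hQ : ∀ z z' : ℝ × E3, Q z z' = -(z.1 * z'.1) + q z.2 z'.2 := fun z z' ↦ by
    simp only [Q, LinearMap.sub_apply, LinearMap.compl₁₂_apply, LinearMap.snd_apply,
      LinearMap.fst_apply, LinearMap.mul_apply']
    ring
  have hn : finrank ℝ (ℝ × E3) = 4 := by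
    rw [finrank_prod, finrank_self, finrank_euclideanSpace_fin]
  have hf : ∀ a b, Q (N a, Y a) (N b, Y b) = if a = b then (if a = 0 then -1 else 1 : ℝ) else 0 :=
    fun a b ↦ by rw [hQ]; exact hG a b
  have h := congrArg Prod.snd (eq_sum_smul_of_gram_eq hn Q (fun a ↦ if a = 0 then -1 else 1)
    Minkowski.sign_mul_sign (fun a ↦ (N a, Y a)) hf ((0 : ℝ), z))
  rw [Prod.snd_sum] at h
  simpa only [hQ, zero_mul, neg_zero, zero_add, Prod.smul_snd] using h

/-! ### Integration of translational KIDs: the developing map -/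

section Developing

open Minkowski

variable {U : Opens E3} (D : InitialDataSet 𝓘(ℝ, E3) U) [D.metric.HasLeviCivita]
  (N : Fin 4 → U → ℝ) (Y : Fin 4 → Π x : U, TangentSpace 𝓘(ℝ, E3) x)

/-- **Translational KIDs with closed duals integrate (developing map, first half).** On a chart
domain `U ⊆ ℝ³`, open and star-shaped, let `D = (h, k)` be an initial data set and
`(N_a, Y_a)_{a<4}` smooth pairs satisfying the first translational KID equation
`h(∇ᵥY_a, w) = −N_a k(v, w)` (Beig–Chruściel 1996, (A.11)). Then there is a `C^∞` map
`f : U → ℝ⁴` with `df_x(v) = (ε_a h(Y_a(x), v))_a`, `ε = (−1, 1, 1, 1)`: the covector fields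
`h(Y_a, ·)` are closed (`mvfderiv_val_kid_comm`) and the Poincaré lemma on the star-shaped `U`
(`exists_contDiffOn_hasFDerivAt_of_fderiv_symm_of_starConvex`) integrates them. Beig–Chruściel,
J. Math. Phys. 37 (1996), proof of Thm. 4.1 (integration of the parallel KIDs on the simply
connected cover). [cite: BeigChrusciel1996, proof of Thm. 4.1] -/
theorem InitialDataSet.exists_developingMap_of_kid {z₀ : E3} (hU : StarConvex ℝ z₀ (U : Set E3))
    (hY : ∀ a, ContMDiff 𝓘(ℝ, E3) (𝓘(ℝ, E3).prod 𝓘(ℝ, E3)) ∞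
      (fun x ↦ (TotalSpace.mk' E3 x (Y a x) : TangentBundle 𝓘(ℝ, E3) U)))
    (hDY : ∀ a (x : U) (v w : E3),
      D.metric.val x (D.metric.leviCivita (Y a) x v) w = -(N a x * D.k x v w)) :
    ∃ f : U → E4, ContMDiff 𝓘(ℝ, E3) 𝓘(ℝ, E4) ∞ f ∧
      ∀ (x : U) (v : E3), mfderiv 𝓘(ℝ, E3) 𝓘(ℝ, E4) f x v =
        WithLp.toLp 2 fun a ↦ (if a = 0 then -1 else 1 : ℝ) * D.h.inner x (Y a x) v := by
  classical
  -- representatives of `Y_a` and of the metric on `E3`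
  set Yr : Fin 4 → E3 → E3 := fun a z ↦ if hz : z ∈ U then Y a ⟨z, hz⟩ else 0 with hYr_def
  set Gr : E3 → E3 →L[ℝ] E3 →L[ℝ] ℝ := fun z ↦ if hz : z ∈ U then D.h.inner ⟨z, hz⟩ else 0
    with hGr_def
  have hYr : ∀ a (y : U), (Y a y : E3) = Yr a y := fun a y ↦ by
    simp only [hYr_def, SetLike.coe_mem, ↓reduceDIte]
  have hGr : ∀ y : U, D.h.inner y = Gr y := fun y ↦ by
    simp only [hGr_def, SetLike.coe_mem, ↓reduceDIte]
  have hYs : ∀ a, ContDiffOn ℝ ∞ (Yr a) U := fun a z hz ↦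
    (((OpensChart.contMDiffAt_section_iff ⟨z, hz⟩ (Y a)).mp (hY a ⟨z, hz⟩)) |>
      (OpensChart.contMDiffAt_iff ⟨z, hz⟩ (fun y : U ↦ (Y a y : E3)) (Yr a) (hYr a)).mp)
      |>.contDiffWithinAt
  have hGs : ContDiffOn ℝ ∞ Gr U := fun z hz ↦
    ((OpensChart.contMDiffAt_bilinSection_iff ⟨z, hz⟩ _ Gr hGr).mp (D.h.contMDiff ⟨z, hz⟩))
      |>.contDiffWithinAt
  -- the covector fields `ℓ_a = h(Y_a, ·)` and the `ℝ⁴`-valued form `A = (ε_a ℓ_a)_a`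
  set ℓ : Fin 4 → E3 → E3 →L[ℝ] ℝ := fun a z ↦ Gr z (Yr a z) with hℓ_def
  have hℓs : ∀ a, ContDiffOn ℝ ∞ (ℓ a) U := fun a ↦ hGs.clm_apply (hYs a)
  set A : E3 → E3 →L[ℝ] E4 := fun z ↦
    (((EuclideanSpace.equiv (Fin 4) ℝ).symm : (Fin 4 → ℝ) →L[ℝ] E4).comp
      (ContinuousLinearMap.pi fun a ↦ (if a = 0 then -1 else 1 : ℝ) • ℓ a z)) with hA_def
  have hA : ∀ z v, A z v = WithLp.toLp 2 fun a ↦ (if a = 0 then -1 else 1 : ℝ) * ℓ a z v :=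
    fun z v ↦ rfl
  have hAi : ∀ z v i, A z v i = (if i = 0 then -1 else 1 : ℝ) * ℓ i z v := fun z v i ↦ by
    rw [hA]
  have hAs : ContDiffOn ℝ ∞ A U := by
    refine contDiffOn_clm_apply.mpr fun v ↦ contDiffOn_euclidean.mpr fun i ↦ ?_
    have : (fun z ↦ A z v i) = fun z ↦ (if i = 0 then -1 else 1 : ℝ) * ℓ i z v :=
      funext fun z ↦ hAi z v i
    rw [this]
    exact contDiffOn_const.mul ((hℓs i).clm_apply contDiffOn_const)
  -- closedness of `A`: componentwise the closedness of `h(Y_a, ·)`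
  have hℓd : ∀ a, ∀ z ∈ (U : Set E3), ∀ w : E3, DifferentiableAt ℝ (fun z ↦ ℓ a z w) z :=
    fun a z hz w ↦ (((hℓs a).clm_apply contDiffOn_const).contDiffAt (U.isOpen.mem_nhds hz)
      |>.differentiableAt (by simp))
  have hclosed : ∀ a, ∀ z ∈ (U : Set E3), ∀ v w : E3,
      fderiv ℝ (fun z ↦ ℓ a z w) z v = fderiv ℝ (fun z ↦ ℓ a z v) z w := by
    intro a z hz v w
    have hYd := (hY a ⟨z, hz⟩).mdifferentiableAt (by simp)
    have key := D.metric.mvfderiv_val_kid_comm D.k hYd (D.k_symm ⟨z, hz⟩) (hDY a ⟨z, hz⟩) v w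
    have hrep : ∀ (u : E3) (y : U), D.metric.val y (Y a y) u = ℓ a y u := fun u y ↦ by
      show D.h.inner y (Y a y) u = Gr y (Yr a y) u
      rw [← hGr, ← hYr]
      exact rfl
    rwa [OpensChart.mvfderiv_eq ⟨z, hz⟩ _ (fun z ↦ ℓ a z w) (hrep w) (hℓd a z hz w),
      OpensChart.mvfderiv_eq ⟨z, hz⟩ _ (fun z ↦ ℓ a z v) (hrep v) (hℓd a z hz v)] at key
  have hsymm : ∀ z ∈ (U : Set E3), ∀ v w : E3, fderiv ℝ A z v w = fderiv ℝ A z w v := by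
    intro z hz v w
    have hAd : DifferentiableAt ℝ A z := (hAs.contDiffAt (U.isOpen.mem_nhds hz)).differentiableAt
      (by simp)
    -- the coordinate `i` of `dA_z(v)(w)` is `ε_i ∂ᵥ[ℓ_i(w)]`
    have hcoord : ∀ (v w : E3) (i : Fin 4), fderiv ℝ A z v w i =
        (if i = 0 then -1 else 1 : ℝ) * fderiv ℝ (fun z ↦ ℓ i z w) z v := by
      intro v w i
      set Φ : (E3 →L[ℝ] E4) →L[ℝ] ℝ :=
        (EuclideanSpace.proj (𝕜 := ℝ) i).comp (ContinuousLinearMap.apply ℝ E4 w) with hΦ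
      have hΦA : (fun z ↦ (if i = 0 then -1 else 1 : ℝ) * ℓ i z w) = Φ ∘ A :=
        funext fun z ↦ (hAi z w i).symm
      have h1 : fderiv ℝ (Φ ∘ A) z = Φ.comp (fderiv ℝ A z) :=
        (Φ.hasFDerivAt.comp z hAd.hasFDerivAt).fderiv
      have h2 : fderiv ℝ (fun z ↦ (if i = 0 then -1 else 1 : ℝ) * ℓ i z w) z v =
          (if i = 0 then -1 else 1 : ℝ) * fderiv ℝ (fun z ↦ ℓ i z w) z v := by
        rw [fderiv_const_mul (hℓd i z hz w)]
        rfl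
      rw [← h2, hΦA, h1]
      rfl
    ext i
    rw [hcoord, hcoord, hclosed i z hz v w]
  -- the Poincaré lemma on the star-shaped chart domain
  obtain ⟨F, hFs, hFd⟩ :=
    Literature.Analysis.Calculus.exists_contDiffOn_hasFDerivAt_of_fderiv_symm_of_starConvex
      U.isOpen hU hAs hsymm
  refine ⟨fun x ↦ F x, fun x ↦ ?_, fun x v ↦ ?_⟩
  · exact (OpensChart.contMDiffAt_iff x (fun y : U ↦ F y) F (fun _ ↦ rfl)).mpr
      (hFs.contDiffAt (U.isOpen.mem_nhds x.2))
  · rw [OpensChart.mfderiv_eq x (fun y : U ↦ F y) F (fun _ ↦ rfl) (hFd x x.2).differentiableAt,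
      (hFd x x.2).fderiv]
    refine (hA x v).trans ?_
    congr 1
    funext a
    show _ * Gr x (Yr a x) v = _
    rw [← hGr, ← hYr]
    exact rfl

/-- **Translational Killing initial data integrate to a spacelike isometric immersion into
Minkowski space-time with the prescribed second fundamental form.** On an open star-shaped chart
domain `U ⊆ ℝ³` let `D = (h, k)` be an initial data set and `(N_a, Y_a)_{a<4}` four smooth pairs
(functions and vector fields) satisfying the translational (parallel) KID system of
Beig–Chruściel 1996, App. A, (A.11)–(A.11.0),

  `h(∇ᵥY_a, w) = −N_a k(v, w)`,  `dN_a(v) = −k(v, Y_a)`,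

whose Gram matrix for the Lorentzian pairing is the Minkowski metric,
`−N_a N_b + h(Y_a, Y_b) = η_{ab}` (the null/translational asymptotic values of the four
Sen-parallel spinor bilinears, transported by the conservation law
`KillingInitialDataPairing.mvfderiv_kidPairing_eq_zero`), and `N₀ > 0`. Then the data are those
induced on a spacelike hypersurface of Minkowski space-time `(ℝ⁴, η, ∂ₜ)`: there are a `C^∞` map
`f : U → ℝ⁴` and a field `ν` along it such that `f` is a spacelike immersion
(`IsSpacelikeImmersion`), `ν` is its future unit normal (`IsFutureUnitNormal`) with `C^∞` lift,
`df_x(v) = (ε_a h(Y_a, v))_a` and `ν = (−ε_a N_a)_a` (`ε = (−1, 1, 1, 1)`; i.e. the constant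
translations `∂_a` of `ℝ⁴` restrict along `f` to `ε_a(N_a ν + df(Y_a))`), the induced metric is
`f^*η = h` and the second fundamental form with respect to `ν` is `K_ν = k`. Proof: `f` is the
developing map of `exists_developingMap_of_kid`; `f^*η = h`, `η(ν, df) = 0`, `η(ν, ν) = −1` are
the completeness relations of the `η`-orthonormal frame `(N_a, Y_a)` of `ℝ ⊕ T_xU`
(`lapseShift_completeness`); `K_ν(v, w) = η(dν v, df w)` in the flat ambient space
(`ModelSpace.secondFundamentalForm_eq_mfderiv`) equals `∑_a ε_a k(v, Y_a) h(Y_a, w) = k(v, w)` by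
the second KID equation and the expansion `w = ∑_a ε_a h(w, Y_a) Y_a`
(`eq_sum_smul_shift_of_gram_eq`). This is the initial-data form of the steps "the Killing
development of the KIDs is flat" and "`Σ` can be locally isometrically embedded in `ℝ⁴`, with
`K` its extrinsic curvature" of the proof of the rigid positive energy theorem, Beig–Chruściel,
J. Math. Phys. 37 (1996), Thm. 4.1 (§4, with App. A (A.11)–(A.11.0)); Wald 1984, §10.2,
(10.2.11)–(10.2.13). [cite: BeigChrusciel1996, proof of Thm. 4.1 and App. A (A.11)–(A.11.0)] -/
theorem InitialDataSet.exists_spacelikeImmersion_minkowski_of_kids {z₀ : E3}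
    (hU : StarConvex ℝ z₀ (U : Set E3))
    (hN : ∀ a, ContMDiff 𝓘(ℝ, E3) 𝓘(ℝ, ℝ) ∞ (N a))
    (hY : ∀ a, ContMDiff 𝓘(ℝ, E3) (𝓘(ℝ, E3).prod 𝓘(ℝ, E3)) ∞
      (fun x ↦ (TotalSpace.mk' E3 x (Y a x) : TangentBundle 𝓘(ℝ, E3) U)))
    (hDY : ∀ a (x : U) (v w : E3),
      D.metric.val x (D.metric.leviCivita (Y a) x v) w = -(N a x * D.k x v w))
    (hdN : ∀ a (x : U) (v : E3), mvfderiv 𝓘(ℝ, E3) (N a) x v = -(D.k x v (Y a x)))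
    (hG : ∀ (x : U) a b, -(N a x * N b x) + D.h.inner x (Y a x) (Y b x) =
      if a = b then (if a = 0 then -1 else 1) else 0)
    (hN0 : ∀ x, 0 < N 0 x) :
    ∃ (f : U → E4) (ν : U → E4),
      smoothMetric.toPseudoRiemannianMetric.IsSpacelikeImmersion 𝓘(ℝ, E3) f ∧
      smoothMetric.IsFutureUnitNormal 𝓘(ℝ, E3) (timeOrientation.ofLE le_top) f ν ∧
      ContMDiff 𝓘(ℝ, E3) 𝓘(ℝ, E4).tangent ∞
        (fun x ↦ (TotalSpace.mk' E4 (f x) (ν x) : TangentBundle 𝓘(ℝ, E4) E4)) ∧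
      (∀ (x : U) (v : E3), mfderiv 𝓘(ℝ, E3) 𝓘(ℝ, E4) f x v =
        WithLp.toLp 2 fun a ↦ (if a = 0 then -1 else 1 : ℝ) * D.h.inner x (Y a x) v) ∧
      (∀ x : U, ν x = WithLp.toLp 2 fun a ↦ -((if a = 0 then -1 else 1 : ℝ) * N a x)) ∧
      (∀ (x : U) (v w : E3),
        smoothMetric.toPseudoRiemannianMetric.inducedBilin 𝓘(ℝ, E3) f x v w = D.h.inner x v w) ∧
      ∀ [smoothMetric.toPseudoRiemannianMetric.HasLeviCivita] (x : U),
        smoothMetric.toPseudoRiemannianMetric.secondFundamentalForm 𝓘(ℝ, E3) f ν x =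
          D.kBilin x := by
  classical
  obtain ⟨f, hf, hdf⟩ := D.exists_developingMap_of_kid N Y hU hY hDY
  set ν : U → E4 := fun x ↦ WithLp.toLp 2 fun a ↦ -((if a = 0 then -1 else 1 : ℝ) * N a x)
    with hν_def
  -- pointwise algebra: the completeness relations of the tetrad `(N_a, Y_a)`
  have hq : ∀ (x : U) (v w : E3),
      (D.h.inner x).toLinearMap₁₂ v w = (D.h.inner x).toLinearMap₁₂ w v :=
    fun x v w ↦ D.h.symm x v w
  have hc := fun x : U ↦ lapseShift_completeness (V := E3) finrank_euclideanSpace_fin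
    (D.h.inner x).toLinearMap₁₂ (hq x) (fun a ↦ N a x) (fun a ↦ Y a x) (hG x)
  have hsgn := Minkowski.sign_mul_sign
  -- `η(df v, df w) = h(v, w)`
  have hind : ∀ (x : U) (v w : E3),
      bilin (WithLp.toLp 2 fun a ↦ (if a = 0 then -1 else 1 : ℝ) * D.h.inner x (Y a x) v)
        (WithLp.toLp 2 fun a ↦ (if a = 0 then -1 else 1 : ℝ) * D.h.inner x (Y a x) w) =
        D.h.inner x v w := by
    intro x v w
    rw [Minkowski.bilin_toLp]
    have h1 := ((hc x).1 v w).symm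
    refine Eq.trans (Finset.sum_congr rfl fun a _ ↦ ?_) h1
    have e := hsgn a
    show _ * (_ * D.h.inner x (Y a x) v) * (_ * D.h.inner x (Y a x) w) =
      _ * D.h.inner x v (Y a x) * D.h.inner x w (Y a x)
    rw [D.h.symm x (Y a x) v, D.h.symm x (Y a x) w]
    linear_combination ((if a = 0 then -1 else 1 : ℝ) * D.h.inner x v (Y a x) *
      D.h.inner x w (Y a x)) * e
  -- `η(ν, df v) = 0`
  have hnor : ∀ (x : U) (v : E3),
      bilin (ν x) (WithLp.toLp 2 fun a ↦ (if a = 0 then -1 else 1 : ℝ) * D.h.inner x (Y a x) v)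
        = 0 := by
    intro x v
    rw [hν_def, Minkowski.bilin_toLp, ← neg_eq_zero, ← Finset.sum_neg_distrib]
    refine Eq.trans (Finset.sum_congr rfl fun a _ ↦ ?_) ((hc x).2.1 v)
    have e := hsgn a
    show -(_ * -(_ * N a x) * (_ * D.h.inner x (Y a x) v)) = _ * N a x * D.h.inner x v (Y a x)
    rw [D.h.symm x (Y a x) v]
    linear_combination ((if a = 0 then -1 else 1 : ℝ) * N a x * D.h.inner x v (Y a x)) * e
  -- `η(ν, ν) = −1`
  have hunit : ∀ x : U, bilin (ν x) (ν x) = -1 := by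
    intro x
    rw [hν_def, Minkowski.bilin_toLp]
    refine Eq.trans (Finset.sum_congr rfl fun a _ ↦ ?_) (hc x).2.2
    have e := hsgn a
    show _ * -(_ * N a x) * -(_ * N a x) = _ * N a x ^ 2
    linear_combination ((if a = 0 then -1 else 1 : ℝ) * N a x ^ 2) * e
  -- smoothness of `ν` as a map `U → ℝ⁴`
  set Nr : Fin 4 → E3 → ℝ := fun a z ↦ if hz : z ∈ U then N a ⟨z, hz⟩ else 0 with hNr_def
  have hNr : ∀ a (y : U), N a y = Nr a y := fun a y ↦ by
    simp only [hNr_def, SetLike.coe_mem, ↓reduceDIte]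
  have hNs : ∀ a, ContDiffOn ℝ ∞ (Nr a) U := fun a z hz ↦
    ((OpensChart.contMDiffAt_iff ⟨z, hz⟩ (N a) (Nr a) (hNr a)).mp (hN a ⟨z, hz⟩))
      |>.contDiffWithinAt
  set νr : E3 → E4 := fun z ↦ WithLp.toLp 2 fun a ↦ -((if a = 0 then -1 else 1 : ℝ) * Nr a z)
    with hνr_def
  have hνr : ∀ y : U, ν y = νr y := fun y ↦ by
    simp only [hν_def, hνr_def, hNr]
  have hνs : ContDiffOn ℝ ∞ νr U :=
    contDiffOn_euclidean.mpr fun i ↦ (contDiffOn_const.mul (hNs i)).neg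
  have hνm : ContMDiff 𝓘(ℝ, E3) 𝓘(ℝ, E4) ∞ ν := fun x ↦
    (OpensChart.contMDiffAt_iff x ν νr hνr).mpr (hνs.contDiffAt (U.isOpen.mem_nhds x.2))
  have hlift : ContMDiff 𝓘(ℝ, E3) 𝓘(ℝ, E4).tangent ∞
      (fun x ↦ (TotalSpace.mk' E4 (f x) (ν x) : TangentBundle 𝓘(ℝ, E4) E4)) := by
    intro x
    rw [contMDiffAt_totalSpace]
    refine ⟨hf x, ?_⟩
    simp only [trivializationAt_model_space_apply]
    exact hνm x
  -- the differential of `ν`: `dν_x(v) = (ε_a k(v, Y_a))_a`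
  have hdν : ∀ (x : U) (v : E3), mfderiv 𝓘(ℝ, E3) 𝓘(ℝ, E4) ν x v =
      WithLp.toLp 2 fun a ↦ (if a = 0 then -1 else 1 : ℝ) * D.k x v (Y a x) := by
    intro x v
    have hNd : ∀ a, DifferentiableAt ℝ (Nr a) x := fun a ↦
      ((hNs a).contDiffAt (U.isOpen.mem_nhds x.2)).differentiableAt (by simp)
    have hνd : DifferentiableAt ℝ νr x :=
      (hνs.contDiffAt (U.isOpen.mem_nhds x.2)).differentiableAt (by simp)
    rw [OpensChart.mfderiv_eq x ν νr hνr hνd]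
    show fderiv ℝ νr x v = _
    ext i
    rw [Minkowski.fderiv_apply_coord hνd i v]
    have h1 : fderiv ℝ (fun z ↦ νr z i) x v =
        -((if i = 0 then -1 else 1 : ℝ) * fderiv ℝ (Nr i) x v) := by
      have hfun : (fun z ↦ νr z i) = fun z ↦ (-(if i = 0 then -1 else 1 : ℝ)) * Nr i z :=
        funext fun z ↦ by
          show -((if i = 0 then -1 else 1 : ℝ) * Nr i z) = _
          rw [neg_mul]
      rw [hfun, ((hNd i).hasFDerivAt.const_mul _).fderiv, _root_.smul_apply, smul_eq_mul, neg_mul]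
    rw [h1, ← OpensChart.mvfderiv_eq x (N i) (Nr i) (hNr i) (hNd i) v, hdN i x v]
    simp only [mul_neg, neg_neg]
  refine ⟨f, ν, ⟨?_, fun x v hv ↦ ?_⟩, ⟨⟨fun x v ↦ ?_, fun x ↦ hunit x⟩, fun x ↦ ⟨⟨?_, ?_⟩, ?_⟩⟩,
    hlift, hdf, fun x ↦ rfl, fun x v w ↦ ?_, ?_⟩
  · -- `f` is `C^∞`
    have h : ((∞ : ℕ∞ω) + 1) = ∞ := rfl
    rw [h]
    exact hf
  · -- spacelike
    rw [PseudoRiemannianMetric.inducedBilin_apply, hdf x]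
    change 0 < bilin _ _
    rw [hind x v v]
    exact D.h.pos x v hv
  · -- normal
    rw [hdf x]
    exact hnor x v
  · -- causal
    change bilin (ν x) (ν x) ≤ 0
    rw [hunit x]
    norm_num
  · intro h0
    have h := hunit x
    rw [show (ν x : E4) = 0 from h0, map_zero] at h
    norm_num at h
  · -- future-directed: `η(∂ₜ, ν) = −N₀ < 0`
    change bilin (E4.basisVector 0) (ν x) < 0
    rw [hν_def, Minkowski.bilin_basisVector_zero_toLp]
    simp only [if_true, neg_mul, one_mul, neg_neg, Left.neg_neg_iff]
    exact hN0 x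
  · -- induced metric
    rw [PseudoRiemannianMetric.inducedBilin_apply, hdf x, hdf x]
    exact hind x v w
  · -- second fundamental form
    intro inst x
    refine LinearMap.ext₂ fun v w ↦ ?_
    have hfx : MDifferentiableAt 𝓘(ℝ, E3) 𝓘(ℝ, E4) f x := (hf x).mdifferentiableAt (by simp)
    have hνx : MDifferentiableAt 𝓘(ℝ, E3) 𝓘(ℝ, E4) (fun y ↦ (ν y : E4)) x :=
      (hνm x).mdifferentiableAt (by simp)
    rw [ModelSpace.secondFundamentalForm_eq_mfderiv (G₀ := bilin) (fun _ ↦ rfl)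
      BoundarylessManifold.isInteriorPoint hfx hνx v w]
    change bilin (mfderiv 𝓘(ℝ, E3) 𝓘(ℝ, E4) ν x v) (mfderiv 𝓘(ℝ, E3) 𝓘(ℝ, E4) f x w) = D.k x v w
    rw [hdν x v, hdf x w, Minkowski.bilin_toLp]
    -- expand `w` in the shifts: `k(v, w) = ∑_a ε_a h(w, Y_a) k(v, Y_a)`
    have hexp := eq_sum_smul_shift_of_gram_eq (D.h.inner x).toLinearMap₁₂ (fun a ↦ N a x)
      (fun a ↦ Y a x) (hG x) w
    have hk1 := congrArg (D.k x v) hexp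
    have hk2 : D.k x v (∑ a, ((if a = 0 then -1 else 1 : ℝ) * D.h.inner x w (Y a x)) • Y a x) =
        ∑ a, (if a = 0 then -1 else 1 : ℝ) * D.h.inner x w (Y a x) * D.k x v (Y a x) := by
      rw [map_sum]
      exact Finset.sum_congr rfl fun a _ ↦ by rw [map_smul, smul_eq_mul]
    refine Eq.trans (Finset.sum_congr rfl fun a _ ↦ ?_) (hk1.trans hk2).symm
    have e := hsgn a
    show _ * (_ * D.k x v (Y a x)) * (_ * D.h.inner x (Y a x) w) =
      _ * D.h.inner x w (Y a x) * D.k x v (Y a x)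
    rw [D.h.symm x (Y a x) w]
    linear_combination ((if a = 0 then -1 else 1 : ℝ) * D.h.inner x w (Y a x) *
      D.k x v (Y a x)) * e

/-- **The Lorentzian Gram matrix of translational KIDs is constant on a connected chart
domain.** Under the KID system (A.11)–(A.11.0) for smooth `(N_a, Y_a)`, `(N_b, Y_b)` on a
preconnected chart domain `U`, the pairing `−N_a N_b + h(Y_a, Y_b)` takes the same value at any
two points: its derivative vanishes identically (`mvfderiv_kidPairing_eq_zero`,
`KillingInitialDataPairing.lean`) and a function with vanishing derivative on a connected open
set is constant (`IsOpen.is_const_of_fderiv_eq_zero`). In the proof of Beig–Chruściel, J. Math.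
Phys. 37 (1996), Thm. 4.1 this transports the asymptotic values of the spinor bilinears
(`(N, Y) → (|n⃗|, n⃗)`, i.e. Gram matrix `η`) to all of `Σ` ("`ĝ(X, X) = −1 ⟹ N² − |Y|² = 1`").
[cite: BeigChrusciel1996, proof of Thm. 4.1, §4] -/
theorem InitialDataSet.kidPairing_eq_of_isPreconnected (hUc : IsPreconnected (U : Set E3))
    (hN : ∀ a, ContMDiff 𝓘(ℝ, E3) 𝓘(ℝ, ℝ) ∞ (N a))
    (hY : ∀ a, ContMDiff 𝓘(ℝ, E3) (𝓘(ℝ, E3).prod 𝓘(ℝ, E3)) ∞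
      (fun x ↦ (TotalSpace.mk' E3 x (Y a x) : TangentBundle 𝓘(ℝ, E3) U)))
    (hDY : ∀ a (x : U) (v w : E3),
      D.metric.val x (D.metric.leviCivita (Y a) x v) w = -(N a x * D.k x v w))
    (hdN : ∀ a (x : U) (v : E3), mvfderiv 𝓘(ℝ, E3) (N a) x v = -(D.k x v (Y a x)))
    (a b : Fin 4) (x x₀ : U) :
    -(N a x * N b x) + D.h.inner x (Y a x) (Y b x) =
      -(N a x₀ * N b x₀) + D.h.inner x₀ (Y a x₀) (Y b x₀) := by
  classical
  have hYd : ∀ c (y : U), MDifferentiableAt 𝓘(ℝ, E3) (𝓘(ℝ, E3).prod 𝓘(ℝ, E3))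
      (fun x ↦ (TotalSpace.mk' E3 x (Y c x) : TangentBundle 𝓘(ℝ, E3) U)) y :=
    fun c y ↦ (hY c y).mdifferentiableAt (by simp)
  have hNd : ∀ c (y : U), MDifferentiableAt 𝓘(ℝ, E3) 𝓘(ℝ, ℝ) (N c) y :=
    fun c y ↦ (hN c y).mdifferentiableAt (by simp)
  -- the pairing and its representative on `E3`
  set φ : U → ℝ := fun y ↦ D.metric.val y (Y a y) (Y b y) - N a y * N b y with hφ_def
  set φr : E3 → ℝ := fun z ↦ if hz : z ∈ U then φ ⟨z, hz⟩ else 0 with hφr_def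
  have hrep : ∀ y : U, φ y = φr y := fun y ↦ by
    simp only [hφr_def, SetLike.coe_mem, ↓reduceDIte]
  have hφd : ∀ y : U, MDifferentiableAt 𝓘(ℝ, E3) 𝓘(ℝ, ℝ) φ y := fun y ↦
    (D.metric.mdifferentiableAt_val_apply (hYd a y) (hYd b y)).sub ((hNd a y).mul (hNd b y))
  have hφrd : ∀ y : U, DifferentiableAt ℝ φr y := fun y ↦
    (OpensChart.mdifferentiableAt_iff y φ φr hrep).mp (hφd y)
  -- its derivative vanishes: the conservation law of the KID pairing
  have hzero : ∀ (y : U) (v : E3), mvfderiv 𝓘(ℝ, E3) φ y v = 0 := fun y v ↦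
    D.metric.mvfderiv_kidPairing_eq_zero D.k (OpensChart.mdifferentiableAt_const_section y v)
      (hYd a y) (hYd b y) (hNd a y) (hNd b y) (fun w ↦ hDY a y v w) (fun w ↦ hDY b y v w)
      (hdN a y v) (hdN b y v)
  have hfz : (U : Set E3).EqOn (fderiv ℝ φr) 0 := fun z hz ↦ by
    ext v
    rw [← OpensChart.mvfderiv_eq ⟨z, hz⟩ φ φr hrep (hφrd ⟨z, hz⟩) v, hzero]
    rfl
  have hconst := U.isOpen.is_const_of_fderiv_eq_zero hUc
    (fun z hz ↦ (hφrd ⟨z, hz⟩).differentiableWithinAt) hfz x.2 x₀.2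
  rw [← hrep, ← hrep] at hconst
  have h1 : φ x = D.h.inner x (Y a x) (Y b x) - N a x * N b x := rfl
  have h2 : φ x₀ = D.h.inner x₀ (Y a x₀) (Y b x₀) - N a x₀ * N b x₀ := rfl
  linarith [h1, h2, hconst]

/-- **Translational KIDs with Minkowskian asymptotic Gram matrix develop the data into Minkowski
space-time** — `exists_spacelikeImmersion_minkowski_of_kids` with the Gram condition and the sign
of `N₀` imposed at a single point `x₀` of the star-shaped (hence connected) chart domain: the Gram
matrix is constant (`kidPairing_eq_of_isPreconnected`), and `N₀² = 1 + h(Y₀, Y₀) ≥ 1` never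
vanishes, so `N₀ > 0` propagates by continuity. Beig–Chruściel, J. Math. Phys. 37 (1996), proof of
Thm. 4.1 (§4) with App. A (A.11)–(A.11.0).
[cite: BeigChrusciel1996, proof of Thm. 4.1 and App. A (A.11)–(A.11.0)] -/
theorem InitialDataSet.exists_spacelikeImmersion_minkowski_of_kids_of_gram_at {z₀ : E3}
    (hz₀ : z₀ ∈ U) (hU : StarConvex ℝ z₀ (U : Set E3))
    (hN : ∀ a, ContMDiff 𝓘(ℝ, E3) 𝓘(ℝ, ℝ) ∞ (N a))
    (hY : ∀ a, ContMDiff 𝓘(ℝ, E3) (𝓘(ℝ, E3).prod 𝓘(ℝ, E3)) ∞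
      (fun x ↦ (TotalSpace.mk' E3 x (Y a x) : TangentBundle 𝓘(ℝ, E3) U)))
    (hDY : ∀ a (x : U) (v w : E3),
      D.metric.val x (D.metric.leviCivita (Y a) x v) w = -(N a x * D.k x v w))
    (hdN : ∀ a (x : U) (v : E3), mvfderiv 𝓘(ℝ, E3) (N a) x v = -(D.k x v (Y a x)))
    (hG : ∀ a b, -(N a ⟨z₀, hz₀⟩ * N b ⟨z₀, hz₀⟩) +
      D.h.inner ⟨z₀, hz₀⟩ (Y a ⟨z₀, hz₀⟩) (Y b ⟨z₀, hz₀⟩) =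
        if a = b then (if a = 0 then -1 else 1) else 0)
    (hN0 : 0 < N 0 ⟨z₀, hz₀⟩) :
    ∃ (f : U → E4) (ν : U → E4),
      smoothMetric.toPseudoRiemannianMetric.IsSpacelikeImmersion 𝓘(ℝ, E3) f ∧
      smoothMetric.IsFutureUnitNormal 𝓘(ℝ, E3) (timeOrientation.ofLE le_top) f ν ∧
      ContMDiff 𝓘(ℝ, E3) 𝓘(ℝ, E4).tangent ∞
        (fun x ↦ (TotalSpace.mk' E4 (f x) (ν x) : TangentBundle 𝓘(ℝ, E4) E4)) ∧
      (∀ (x : U) (v : E3), mfderiv 𝓘(ℝ, E3) 𝓘(ℝ, E4) f x v =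
        WithLp.toLp 2 fun a ↦ (if a = 0 then -1 else 1 : ℝ) * D.h.inner x (Y a x) v) ∧
      (∀ x : U, ν x = WithLp.toLp 2 fun a ↦ -((if a = 0 then -1 else 1 : ℝ) * N a x)) ∧
      (∀ (x : U) (v w : E3),
        smoothMetric.toPseudoRiemannianMetric.inducedBilin 𝓘(ℝ, E3) f x v w = D.h.inner x v w) ∧
      ∀ [smoothMetric.toPseudoRiemannianMetric.HasLeviCivita] (x : U),
        smoothMetric.toPseudoRiemannianMetric.secondFundamentalForm 𝓘(ℝ, E3) f ν x =
          D.kBilin x := by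
  have hUc : IsPreconnected (U : Set E3) := (hU.isPathConnected hz₀).isConnected.isPreconnected
  have hG' : ∀ (x : U) a b, -(N a x * N b x) + D.h.inner x (Y a x) (Y b x) =
      if a = b then (if a = 0 then -1 else 1) else 0 := fun x a b ↦ by
    rw [D.kidPairing_eq_of_isPreconnected N Y hUc hN hY hDY hdN a b x ⟨z₀, hz₀⟩]
    exact hG a b
  -- `N₀² ≥ 1`, so `N₀` does not vanish and keeps its sign on the connected `U`
  have hsq : ∀ x : U, 1 ≤ N 0 x ^ 2 := fun x ↦ by
    have h := hG' x 0 0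
    simp only [if_true] at h
    have hnn : 0 ≤ D.h.inner x (Y 0 x) (Y 0 x) := by
      by_cases h0 : Y 0 x = 0
      · rw [h0, map_zero]
      · exact (D.h.pos x (Y 0 x) h0).le
    nlinarith [h, hnn]
  have hne : ∀ x : U, N 0 x ≠ 0 := fun x h0 ↦ by
    have h := hsq x
    rw [h0] at h
    norm_num at h
  have hN0' : ∀ x : U, 0 < N 0 x := by
    intro x
    by_contra hx
    rw [not_lt] at hx
    haveI : PreconnectedSpace U := isPreconnected_iff_preconnectedSpace.mp hUc
    obtain ⟨y, hy⟩ := intermediate_value_univ x ⟨z₀, hz₀⟩ (hN 0).continuous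
      ⟨hx, hN0.le⟩
    exact hne y hy
  exact D.exists_spacelikeImmersion_minkowski_of_kids N Y hU hN hY hDY hdN hG' hN0'

/-! ### Consequences: the vacuum constraints; the sign of the lapses -/

/-- **Data induced by a spacelike immersion into Minkowski space-time solve the vacuum constraint
equations** (Gauss–Codazzi with `Ric(η) = 0`,
`InitialDataSet.isVacuumConstraintSolution_of_eq_induced` of `InducedVacuumData.lean`): if
`f : N → ℝ⁴` is a spacelike immersion of the `3`-manifold `N` (modelled on `ℝ³`) with timelike
unit normal `ν` of smooth lift, and the data set `D` on `N` has `h = f^*η` and `k = K_ν`, then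
`R(h) − |k|² + (tr k)² = 0` and `div k − d(tr k) = 0`.
Choquet-Bruhat 2009, Ch. VI, Thm. 3.3; Bartnik–Isenberg 2004, (2.1)–(2.2).
[cite: ChoquetBruhat2009, Ch. VI, Thm. 3.3] -/
theorem InitialDataSet.isVacuumConstraintSolution_of_minkowski_immersion {N' : Type*}
    [TopologicalSpace N'] [ChartedSpace E3 N'] [IsManifold 𝓘(ℝ, E3) ∞ N']
    (D' : InitialDataSet 𝓘(ℝ, E3) N') [D'.metric.HasLeviCivita] {f : N' → E4} {ν : N' → E4}
    (hfi : smoothMetric.toPseudoRiemannianMetric.IsSpacelikeImmersion 𝓘(ℝ, E3) f)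
    (hun : smoothMetric.toPseudoRiemannianMetric.IsUnitNormal 𝓘(ℝ, E3) f ν (-1))
    (hlift : ContMDiff 𝓘(ℝ, E3) 𝓘(ℝ, E4).tangent ∞
      (fun x ↦ (TotalSpace.mk' E4 (f x) (ν x) : TangentBundle 𝓘(ℝ, E4) E4)))
    (hind : ∀ (x : N') (v w : E3),
      smoothMetric.toPseudoRiemannianMetric.inducedBilin 𝓘(ℝ, E3) f x v w = D'.h.inner x v w)
    (hK : ∀ [smoothMetric.toPseudoRiemannianMetric.HasLeviCivita] (x : N'),
      smoothMetric.toPseudoRiemannianMetric.secondFundamentalForm 𝓘(ℝ, E3) f ν x = D'.kBilin x) :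
    D'.IsVacuumConstraintSolution := by
  haveI := smoothMetric.toPseudoRiemannianMetric.hasLeviCivita
  refine InitialDataSet.isVacuumConstraintSolution_of_eq_induced
    smoothMetric.toPseudoRiemannianMetric D' hfi hun hlift (m := 3) finrank_euclideanSpace_fin
    finrank_euclideanSpace_fin
    (fun y ↦ smoothMetric.toPseudoRiemannianMetric.ricci_eq_zero_of_val_eq_const bilin
      (fun _ ↦ rfl) (by decide) _)
    (fun y v w ↦ ?_) (fun y v w ↦ ?_)
  · rw [← PseudoRiemannianMetric.inducedBilin_apply]
    exact (hind y v w).symm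
  · rw [hK y]
    rfl

/-- **Translational KIDs force the vacuum constraints.** On an open star-shaped chart domain
`U ⊆ ℝ³`, a data set carrying four smooth solutions `(N_a, Y_a)` of the translational KID system
(A.11)–(A.11.0) with Minkowskian Gram matrix and `N₀ > 0` solves the vacuum constraint equations:
it is induced by a spacelike immersion into Minkowski space-time
(`exists_spacelikeImmersion_minkowski_of_kids`,
`isVacuumConstraintSolution_of_minkowski_immersion`). This is the clause "Moreover, we must
have `ρ ≡ Jⁱ ≡ 0`" of Beig–Chruściel, J. Math. Phys. 37 (1996), Thm. 4.1, in the KID formulation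
of its proof. [cite: BeigChrusciel1996, Thm. 4.1] -/
theorem InitialDataSet.isVacuumConstraintSolution_of_kids {z₀ : E3}
    (hU : StarConvex ℝ z₀ (U : Set E3))
    (hN : ∀ a, ContMDiff 𝓘(ℝ, E3) 𝓘(ℝ, ℝ) ∞ (N a))
    (hY : ∀ a, ContMDiff 𝓘(ℝ, E3) (𝓘(ℝ, E3).prod 𝓘(ℝ, E3)) ∞
      (fun x ↦ (TotalSpace.mk' E3 x (Y a x) : TangentBundle 𝓘(ℝ, E3) U)))
    (hDY : ∀ a (x : U) (v w : E3),
      D.metric.val x (D.metric.leviCivita (Y a) x v) w = -(N a x * D.k x v w))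
    (hdN : ∀ a (x : U) (v : E3), mvfderiv 𝓘(ℝ, E3) (N a) x v = -(D.k x v (Y a x)))
    (hG : ∀ (x : U) a b, -(N a x * N b x) + D.h.inner x (Y a x) (Y b x) =
      if a = b then (if a = 0 then -1 else 1) else 0)
    (hN0 : ∀ x, 0 < N 0 x) : D.IsVacuumConstraintSolution := by
  obtain ⟨f, ν, hfi, hfun, hlift, -, -, hind, hK⟩ :=
    D.exists_spacelikeImmersion_minkowski_of_kids N Y hU hN hY hDY hdN hG hN0
  exact D.isVacuumConstraintSolution_of_minkowski_immersion hfi hfun.1 hlift hind hK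

/-- **Reversing the sign of translational KIDs.** The KID system (A.11)–(A.11.0) is linear and the
Lorentzian Gram pairing is quadratic, so `(−N_a, −Y_a)` is again a smooth solution with the same
Gram matrix (linearity of the Levi-Civita connection on differentiable sections,
`IsCovariantDerivativeOn.smul_const`, and of `mvfderiv`). Used to normalise `N₀ > 0`
(future-directed normal) in the proof of Beig–Chruściel, J. Math. Phys. 37 (1996), Thm. 4.1.
[cite: BeigChrusciel1996, proof of Thm. 4.1, §4] -/
theorem InitialDataSet.kids_neg
    (hN : ∀ a, ContMDiff 𝓘(ℝ, E3) 𝓘(ℝ, ℝ) ∞ (N a))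
    (hY : ∀ a, ContMDiff 𝓘(ℝ, E3) (𝓘(ℝ, E3).prod 𝓘(ℝ, E3)) ∞
      (fun x ↦ (TotalSpace.mk' E3 x (Y a x) : TangentBundle 𝓘(ℝ, E3) U)))
    (hDY : ∀ a (x : U) (v w : E3),
      D.metric.val x (D.metric.leviCivita (Y a) x v) w = -(N a x * D.k x v w))
    (hdN : ∀ a (x : U) (v : E3), mvfderiv 𝓘(ℝ, E3) (N a) x v = -(D.k x v (Y a x))) :
    (∀ a, ContMDiff 𝓘(ℝ, E3) 𝓘(ℝ, ℝ) ∞ (fun x ↦ -N a x)) ∧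
    (∀ a, ContMDiff 𝓘(ℝ, E3) (𝓘(ℝ, E3).prod 𝓘(ℝ, E3)) ∞
      (fun x ↦ (TotalSpace.mk' E3 x ((-1 : ℝ) • Y a x) : TangentBundle 𝓘(ℝ, E3) U))) ∧
    (∀ a (x : U) (v w : E3),
      D.metric.val x (D.metric.leviCivita (fun x ↦ (-1 : ℝ) • Y a x) x v) w =
        -(-N a x * D.k x v w)) ∧
    (∀ a (x : U) (v : E3),
      mvfderiv 𝓘(ℝ, E3) (fun x ↦ -N a x) x v = -(D.k x v ((-1 : ℝ) • Y a x))) ∧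
    ∀ (x : U) a b, -(-N a x * -N b x) + D.h.inner x ((-1 : ℝ) • Y a x) ((-1 : ℝ) • Y b x) =
      -(N a x * N b x) + D.h.inner x (Y a x) (Y b x) := by
  have hYs : ∀ a (x : U), ContMDiffAt 𝓘(ℝ, E3) (𝓘(ℝ, E3).prod 𝓘(ℝ, E3)) ∞
      (fun x ↦ (TotalSpace.mk' E3 x ((-1 : ℝ) • Y a x) : TangentBundle 𝓘(ℝ, E3) U)) x := by
    intro a x
    have hfun : (fun y : U ↦ ((-1 : ℝ) • Y a y : E3)) = fun y ↦ -(Y a y : E3) :=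
      funext fun y ↦ neg_one_smul ℝ _
    rw [OpensChart.contMDiffAt_section_iff, hfun]
    exact ((OpensChart.contMDiffAt_section_iff x (Y a)).mp (hY a x)).neg
  refine ⟨fun a ↦ (hN a).neg, fun a x ↦ hYs a x, fun a x v w ↦ ?_, fun a x v ↦ ?_,
    fun x a b ↦ ?_⟩
  · have hYd := (hY a x).mdifferentiableAt (by simp)
    have h := D.metric.leviCivita.isCovariantDerivativeOn.smul_const (-1 : ℝ) hYd
    have h' : D.metric.leviCivita (fun x ↦ (-1 : ℝ) • Y a x) x v =
        (-1 : ℝ) • D.metric.leviCivita (Y a) x v := by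
      rw [show (fun x ↦ (-1 : ℝ) • Y a x) = (-1 : ℝ) • Y a from rfl, h]
      rfl
    have h2 := hDY a x v w
    have h3 : D.metric.val x (D.metric.leviCivita (fun x ↦ (-1 : ℝ) • Y a x) x v) w =
        (-1 : ℝ) * D.metric.val x (D.metric.leviCivita (Y a) x v) w := by
      rw [h', map_smul, _root_.smul_apply, smul_eq_mul]
    rw [h3, h2]
    ring
  · rw [mvfderiv_fun_neg, _root_.neg_apply, hdN, map_smul, smul_eq_mul]
    ring
  · rw [map_smul, map_smul, _root_.smul_apply, smul_eq_mul, smul_eq_mul]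
    ring

/-- **Translational KIDs with Minkowskian Gram matrix at one point force the vacuum constraints**,
with no sign condition: the Gram matrix is constant on the star-shaped (connected) domain
(`kidPairing_eq_of_isPreconnected`), `N₀² = 1 + h(Y₀, Y₀) ≥ 1`, and if `N₀ < 0` at the base point
the reversed KIDs `(−N_a, −Y_a)` (`kids_neg`) have `N₀ > 0` there; either way
`exists_spacelikeImmersion_minkowski_of_kids_of_gram_at` embeds the data into Minkowski
space-time, so they are vacuum (`isVacuumConstraintSolution_of_minkowski_immersion`).
Beig–Chruściel, J. Math. Phys. 37 (1996), Thm. 4.1 ("`ρ ≡ Jⁱ ≡ 0`") with App. A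
(A.11)–(A.11.0). [cite: BeigChrusciel1996, Thm. 4.1 and App. A (A.11)–(A.11.0)] -/
theorem InitialDataSet.isVacuumConstraintSolution_of_kids_of_gram_at {z₀ : E3} (hz₀ : z₀ ∈ U)
    (hU : StarConvex ℝ z₀ (U : Set E3))
    (hN : ∀ a, ContMDiff 𝓘(ℝ, E3) 𝓘(ℝ, ℝ) ∞ (N a))
    (hY : ∀ a, ContMDiff 𝓘(ℝ, E3) (𝓘(ℝ, E3).prod 𝓘(ℝ, E3)) ∞
      (fun x ↦ (TotalSpace.mk' E3 x (Y a x) : TangentBundle 𝓘(ℝ, E3) U)))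
    (hDY : ∀ a (x : U) (v w : E3),
      D.metric.val x (D.metric.leviCivita (Y a) x v) w = -(N a x * D.k x v w))
    (hdN : ∀ a (x : U) (v : E3), mvfderiv 𝓘(ℝ, E3) (N a) x v = -(D.k x v (Y a x)))
    (hG : ∀ a b, -(N a ⟨z₀, hz₀⟩ * N b ⟨z₀, hz₀⟩) +
      D.h.inner ⟨z₀, hz₀⟩ (Y a ⟨z₀, hz₀⟩) (Y b ⟨z₀, hz₀⟩) =
        if a = b then (if a = 0 then -1 else 1) else 0) :
    D.IsVacuumConstraintSolution := by
  -- `N₀ ≠ 0` at the base point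
  have hsq : 1 ≤ N 0 ⟨z₀, hz₀⟩ ^ 2 := by
    have h := hG 0 0
    simp only [if_true] at h
    have hnn : 0 ≤ D.h.inner ⟨z₀, hz₀⟩ (Y 0 ⟨z₀, hz₀⟩) (Y 0 ⟨z₀, hz₀⟩) := by
      by_cases h0 : Y 0 ⟨z₀, hz₀⟩ = 0
      · rw [h0, map_zero]
      · exact (D.h.pos ⟨z₀, hz₀⟩ (Y 0 ⟨z₀, hz₀⟩) h0).le
    nlinarith [h, hnn]
  have hne : N 0 ⟨z₀, hz₀⟩ ≠ 0 := fun h0 ↦ by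
    rw [h0] at hsq
    norm_num at hsq
  rcases lt_or_gt_of_ne hne with hneg | hpos
  · -- reverse the KIDs
    obtain ⟨hN', hY', hDY', hdN', hG'⟩ := D.kids_neg N Y hN hY hDY hdN
    obtain ⟨f, ν, hfi, hfun, hlift, -, -, hind, hK⟩ :=
      D.exists_spacelikeImmersion_minkowski_of_kids_of_gram_at (fun a x ↦ -N a x)
        (fun a x ↦ (-1 : ℝ) • Y a x) hz₀ hU hN' hY' hDY' hdN'
        (fun a b ↦ by rw [hG' ⟨z₀, hz₀⟩ a b]; exact hG a b) (by linarith)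
    exact D.isVacuumConstraintSolution_of_minkowski_immersion hfi hfun.1 hlift hind hK
  · obtain ⟨f, ν, hfi, hfun, hlift, -, -, hind, hK⟩ :=
      D.exists_spacelikeImmersion_minkowski_of_kids_of_gram_at N Y hz₀ hU hN hY hDY hdN hG hpos
    exact D.isVacuumConstraintSolution_of_minkowski_immersion hfi hfun.1 hlift hind hK

end Developing

end Literature.Geometry.Lorentzian

end
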